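import Summits.AtomisticToContinuum.Crystallization.Theses.NashClassCertificates

/-!
# Crux `NashTwoShellGap` (stmt-AtomisticToContinuum-16826), line `bulk_dilute`:
# the crux implies its dilute stub

Kernel-checked bookkeeping for the lead's registered stub `stub_diluteOfCrux` (line
`bulk_dilute`): the dilute stub — the crux restricted to `1/2`-separated Nash configurations
whose bad count is at most `β₀ · N` — asks nothing the crux

  `NashTwoShellGap : ∃ g > 0, ∀ N x, 1/3-separated → Nash → N·e* + g·#bad ≤ 𝓔_LJ(x)`

does not: `1/2`-separation implies `1/3`-separation, the Nash clause is passed through verbatim,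
and the dilute-fraction hypothesis is simply dropped (any `β₀ > 0`, here `β₀ := 1`, works).
No definitions; `[folklore]`.
-/

noncomputable section

namespace Summit.AtomisticToContinuum.Crystallization.Theorems.NashTwoShellGapDiluteOfCrux

open scoped BigOperators Classical
open Literature.MathematicalPhysics.StatisticalMechanics Literature.Geometry.DiscreteGeometry
open Summit.AtomisticToContinuum.Crystallization.Theses

/-- **Registered sub-goal `stub_diluteOfCrux`** (lead, line `bulk_dilute`): the Nash-class crux
`NashTwoShellGap` implies the line's dilute stub — the same coercive two-shell gap on the smaller
class of `1/2`-separated Nash configurations with bad count at most `β₀ · N` (with `β₀ := 1` and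
the crux's own gap constant `g`). [folklore] -/
theorem stub_diluteOfCrux : Summit.AtomisticToContinuum.Crystallization.Theses.NashClassCertificates.NashTwoShellGap → ∃ β₀ : ℝ, 0 < β₀ ∧ ∃ g : ℝ, 0 < g ∧ ∀ (N : ℕ) (x : Fin N → EuclideanSpace ℝ (Fin 3)), (∀ i j : Fin N, i ≠ j → 1 / 2 ≤ dist (x i) (x j)) → (∀ (i : Fin N) (y : EuclideanSpace ℝ (Fin 3)), (∀ j : Fin N, j ≠ i → y ≠ x j) → Literature.MathematicalPhysics.StatisticalMechanics.siteEnergy Literature.MathematicalPhysics.StatisticalMechanics.lennardJones x i ≤ ∑ j ∈ Finset.univ.erase i, Literature.MathematicalPhysics.StatisticalMechanics.lennardJones (dist y (x j))) → (Nat.card {i : Fin N // ¬ Literature.Geometry.DiscreteGeometry.IsTwoShellGood (1 / 20) (47 / 50) 1 x i} : ℝ) ≤ β₀ * N → (N : ℝ) * (⨅ Q : Literature.MathematicalPhysics.StatisticalMechanics.PeriodicConfiguration 3, Q.energyPerParticle Literature.MathematicalPhysics.StatisticalMechanics.lennardJones) + g * (Nat.card {i : Fin N // ¬ Literature.Geometry.DiscreteGeometry.IsTwoShellGood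 (1 / 20) (47 / 50) 1 x i} : ℝ) ≤ Literature.MathematicalPhysics.StatisticalMechanics.interactionEnergy Literature.MathematicalPhysics.StatisticalMechanics.lennardJones x := by
  intro h
  obtain ⟨g, hg, hG⟩ := h
  refine ⟨1, one_pos, g, hg, fun N x hsep hnash _ => ?_⟩
  have hsep3 : ∀ i j : Fin N, i ≠ j → (1 / 3 : ℝ) ≤ dist (x i) (x j) :=
    fun i j hij => le_trans (by norm_num) (hsep i j hij)
  exact hG N x hsep3 hnash

end Summit.AtomisticToContinuum.Crystallization.Theorems.NashTwoShellGapDiluteOfCrux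

end
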